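import Mathlib
import Literature.Analysis.FluidPDE.AxisymmetricEuler
import Literature.Analysis.FluidPDE.AxisymmetricVorticityTransport
import Literature.Analysis.FluidPDE.VectorCalculus
import Summits.NavierStokesRegularity.NavierStokesRegularity.Theorems.EulerZoomLiouvillePowerGaugeEulerLiouvilleHoopDefs

/-!
# Hoop core — H-FRAME: the cylindrical frame along the circles `axisPt s t ·` and the θ̂-column of `DV`

Sub-problem `NavierStokesRegularity`, crux `PowerGaugeEulerLiouville` (a crux CLASS of self-similar Euler/NS strata — not NS
regularity).  Pointwise frame calculus for the hoop inequality `HoopCore.HoopInequality` (HOOP-NOTE §4, split (a) H-FRAME of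
K-HOOP): at the point `y = axisPt s t θ` (`t > 0`) of the circle of radius `t` at height `s` about the `x₂`-axis,
* the polar frame is the rotated standard basis: `eR y = R_θ e₀`, `eTheta y = R_θ e₁`, `eZ = R_θ e₂`;
* `|DV(y)|_F² = ‖DV ê_r‖² + ‖DV ê_θ‖² + ‖DV ê_z‖²` (`frobeniusNormSq_eq_sum` in that basis), in particular `|DV|_F² ≥ ‖DV ê_θ‖²`;
* `∂_θ axisPt = t ê_θ`, `∂_θ ê_r = ê_θ`, `∂_θ ê_θ = −ê_r` along the circle, hence the component laws
  `∂_θ V_r = t⟪DV ê_θ, ê_r⟫ + V_θ`, `∂_θ V_θ = t⟪DV ê_θ, ê_θ⟫ − V_r`, `∂_θ V_z = t⟪DV ê_θ, ê_z⟫`;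
* the θ̂-COLUMN IDENTITY `t² ‖DV ê_θ‖² = (∂_θV_r − V_θ)² + (∂_θV_θ + V_r)² + (∂_θV_z)²`.
-/

noncomputable section

set_option linter.dupNamespace false

open Set Function WithLp
open scoped InnerProductSpace RealInnerProductSpace

namespace Summit.NavierStokesRegularity.NavierStokesRegularity.Theorems.PowerGaugeEulerLiouville.HoopCore

open Literature.Analysis Literature.Analysis.FluidPDE

/-! ### The circle point and the frame at it -/

/-- `axisPt s t θ = (t cos θ) e₀ + (t sin θ) e₁ + s e₂`. [folklore] -/
theorem axisPt_eq (s t θ : ℝ) : axisPt s t θ =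
    (t * Real.cos θ) • EuclideanSpace.single (0 : Fin 3) (1 : ℝ) +
      (t * Real.sin θ) • EuclideanSpace.single (1 : Fin 3) (1 : ℝ) + s • EuclideanSpace.single (2 : Fin 3) (1 : ℝ) := by
  ext i
  fin_cases i <;> simp [axisPt, rotZ, eZ, mul_comm]

/-- Components of the circle point. [folklore] -/
theorem axisPt_apply (s t θ : ℝ) :
    axisPt s t θ 0 = t * Real.cos θ ∧ axisPt s t θ 1 = t * Real.sin θ ∧ axisPt s t θ 2 = s := by
  refine ⟨?_, ?_, ?_⟩ <;> simp [axisPt_eq]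

/-- The circle `axisPt s t ·` has cylindrical radius `t` (`t ≥ 0`). [folklore] -/
theorem cylRadius_axisPt (s : ℝ) {t : ℝ} (ht : 0 ≤ t) (θ : ℝ) : cylRadius (axisPt s t θ) = t := by
  obtain ⟨h0, h1, -⟩ := axisPt_apply s t θ
  rw [cylRadius, h0, h1, show (t * Real.cos θ) ^ 2 + (t * Real.sin θ) ^ 2 = t ^ 2 by
    linear_combination t ^ 2 * Real.cos_sq_add_sin_sq θ, Real.sqrt_sq ht]

/-- The circle point lies in the solid cylinder iff its height and radius do. [folklore] -/
theorem axisPt_mem_solidCyl {s₁ s₂ T₀ s t : ℝ} (ht : 0 ≤ t) (θ : ℝ) :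
    axisPt s t θ ∈ solidCyl s₁ s₂ T₀ ↔ s₁ ≤ s ∧ s ≤ s₂ ∧ t ≤ T₀ := by
  simp only [solidCyl, mem_setOf_eq, (axisPt_apply s t θ).2.2, cylRadius_axisPt s ht θ]

/-- The radial frame vector on the circle is the rotated `e₀`: `eR (axisPt s t θ) = R_θ e₀ = (cos θ, sin θ, 0)` (`t > 0`). [folklore] -/
theorem eR_axisPt (s : ℝ) {t : ℝ} (ht : 0 < t) (θ : ℝ) :
    eR (axisPt s t θ) = rotZ θ (EuclideanSpace.single (0 : Fin 3) (1 : ℝ)) := by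
  have hr := cylRadius_axisPt s ht.le θ
  obtain ⟨h0, h1, -⟩ := axisPt_apply s t θ
  ext i
  fin_cases i <;> simp [eR, hr, h0, h1, rotZ] <;> field_simp

/-- The angular frame vector on the circle is the rotated `e₁`: `eTheta (axisPt s t θ) = R_θ e₁ = (−sin θ, cos θ, 0)` (`t > 0`).
[folklore] -/
theorem eTheta_axisPt (s : ℝ) {t : ℝ} (ht : 0 < t) (θ : ℝ) :
    eTheta (axisPt s t θ) = rotZ θ (EuclideanSpace.single (1 : Fin 3) (1 : ℝ)) := by
  have hr := cylRadius_axisPt s ht.le θ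
  obtain ⟨h0, h1, -⟩ := axisPt_apply s t θ
  ext i
  fin_cases i <;> simp [eTheta, hr, h0, h1, rotZ] <;> field_simp

/-- The axial frame vector is the (rotation-fixed) `e₂`. [folklore] -/
theorem eZ_eq_rotZ (θ : ℝ) : eZ = rotZ θ (EuclideanSpace.single (2 : Fin 3) (1 : ℝ)) := by
  ext i
  fin_cases i <;> simp [eZ, rotZ]

/-! ### The Frobenius norm in the polar frame -/

/-- **POLAR-FRAME SPLIT OF THE FROBENIUS NORM** on the circle (`t > 0`, `y = axisPt s t θ`): for every linear `L`,
`|L|_F² = ‖L ê_r‖² + ‖L ê_θ‖² + ‖L ê_z‖²` (`frobeniusNormSq_eq_sum` in the rotated standard basis). [folklore] -/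
theorem frobeniusNormSq_eq_polarFrame (L : EuclideanSpace ℝ (Fin 3) →L[ℝ] EuclideanSpace ℝ (Fin 3)) (s : ℝ) {t : ℝ}
    (ht : 0 < t) (θ : ℝ) :
    frobeniusNormSq L = ‖L (eR (axisPt s t θ))‖ ^ 2 + ‖L (eTheta (axisPt s t θ))‖ ^ 2 + ‖L eZ‖ ^ 2 := by
  rw [frobeniusNormSq_eq_sum ((EuclideanSpace.basisFun (Fin 3) ℝ).map (rotZLIE θ)) L, Fin.sum_univ_three]
  simp only [OrthonormalBasis.map_apply, EuclideanSpace.basisFun_apply, rotZLIE_apply]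
  rw [eR_axisPt s ht, eTheta_axisPt s ht, eZ_eq_rotZ θ]

/-- **PARSEVAL IN THE POLAR FRAME** on the circle (`t > 0`, `y = axisPt s t θ`): `‖w‖² = ⟪w, ê_r⟫² + ⟪w, ê_θ⟫² + ⟪w, ê_z⟫²`. [folklore] -/
theorem norm_sq_eq_polarFrame (w : EuclideanSpace ℝ (Fin 3)) (s : ℝ) {t : ℝ} (ht : 0 < t) (θ : ℝ) :
    ‖w‖ ^ 2 = ⟪w, eR (axisPt s t θ)⟫ ^ 2 + ⟪w, eTheta (axisPt s t θ)⟫ ^ 2 + ⟪w, eZ⟫ ^ 2 := by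
  rw [← ((EuclideanSpace.basisFun (Fin 3) ℝ).map (rotZLIE θ)).sum_sq_inner_right w, Fin.sum_univ_three]
  simp only [OrthonormalBasis.map_apply, EuclideanSpace.basisFun_apply, rotZLIE_apply]
  rw [eR_axisPt s ht, eTheta_axisPt s ht, eZ_eq_rotZ θ, real_inner_comm w, real_inner_comm w, real_inner_comm w]

/-- The θ̂-column is a lower bound for the Frobenius norm: `‖L ê_θ‖² ≤ |L|_F²` on the circle (`t > 0`). [folklore] -/
theorem norm_sq_apply_eTheta_le_frobeniusNormSq (L : EuclideanSpace ℝ (Fin 3) →L[ℝ] EuclideanSpace ℝ (Fin 3)) (s : ℝ)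
    {t : ℝ} (ht : 0 < t) (θ : ℝ) :
    ‖L (eTheta (axisPt s t θ))‖ ^ 2 ≤ frobeniusNormSq L := by
  rw [frobeniusNormSq_eq_polarFrame L s ht θ]
  nlinarith [sq_nonneg ‖L (eR (axisPt s t θ))‖, sq_nonneg ‖L eZ‖]

/-! ### Derivatives along the circle -/

/-- `∂_θ axisPt s t θ = t • ê_θ`. [folklore] -/
theorem hasDerivAt_axisPt (s : ℝ) {t : ℝ} (ht : 0 < t) (θ : ℝ) :
    HasDerivAt (fun θ => axisPt s t θ) (t • eTheta (axisPt s t θ)) θ := by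
  have h : HasDerivAt (fun θ => (t * Real.cos θ) • EuclideanSpace.single (0 : Fin 3) (1 : ℝ) +
      (t * Real.sin θ) • EuclideanSpace.single (1 : Fin 3) (1 : ℝ) + s • EuclideanSpace.single (2 : Fin 3) (1 : ℝ))
      ((t * -Real.sin θ) • EuclideanSpace.single (0 : Fin 3) (1 : ℝ) +
        (t * Real.cos θ) • EuclideanSpace.single (1 : Fin 3) (1 : ℝ) + 0) θ :=
    ((((Real.hasDerivAt_cos θ).const_mul t).smul_const _).add
      (((Real.hasDerivAt_sin θ).const_mul t).smul_const _)).add (hasDerivAt_const θ _)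
  have e1 : (fun θ => axisPt s t θ) = fun θ => (t * Real.cos θ) • EuclideanSpace.single (0 : Fin 3) (1 : ℝ) +
      (t * Real.sin θ) • EuclideanSpace.single (1 : Fin 3) (1 : ℝ) + s • EuclideanSpace.single (2 : Fin 3) (1 : ℝ) := by
    funext θ; exact axisPt_eq s t θ
  have e2 : t • eTheta (axisPt s t θ) = (t * -Real.sin θ) • EuclideanSpace.single (0 : Fin 3) (1 : ℝ) +
      (t * Real.cos θ) • EuclideanSpace.single (1 : Fin 3) (1 : ℝ) + 0 := by
    rw [eTheta_axisPt s ht θ]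
    ext i
    fin_cases i <;> simp [rotZ]
  rw [e1, e2]
  exact h

/-- `∂_θ ê_r = ê_θ` along the circle (`t > 0`). [folklore] -/
theorem hasDerivAt_eR_axisPt (s : ℝ) {t : ℝ} (ht : 0 < t) (θ : ℝ) :
    HasDerivAt (fun θ => eR (axisPt s t θ)) (eTheta (axisPt s t θ)) θ := by
  have h : HasDerivAt (fun θ => Real.cos θ • EuclideanSpace.single (0 : Fin 3) (1 : ℝ) +
      Real.sin θ • EuclideanSpace.single (1 : Fin 3) (1 : ℝ))
      (-Real.sin θ • EuclideanSpace.single (0 : Fin 3) (1 : ℝ) +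
        Real.cos θ • EuclideanSpace.single (1 : Fin 3) (1 : ℝ)) θ :=
    ((Real.hasDerivAt_cos θ).smul_const _).add ((Real.hasDerivAt_sin θ).smul_const _)
  have e1 : (fun θ => eR (axisPt s t θ)) = fun θ => Real.cos θ • EuclideanSpace.single (0 : Fin 3) (1 : ℝ) +
      Real.sin θ • EuclideanSpace.single (1 : Fin 3) (1 : ℝ) := by
    funext θ
    rw [eR_axisPt s ht θ]
    ext i
    fin_cases i <;> simp [rotZ]
  have e2 : eTheta (axisPt s t θ) = -Real.sin θ • EuclideanSpace.single (0 : Fin 3) (1 : ℝ) +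
      Real.cos θ • EuclideanSpace.single (1 : Fin 3) (1 : ℝ) := by
    rw [eTheta_axisPt s ht θ]
    ext i
    fin_cases i <;> simp [rotZ]
  rw [e1, e2]
  exact h

/-- `∂_θ ê_θ = −ê_r` along the circle (`t > 0`). [folklore] -/
theorem hasDerivAt_eTheta_axisPt (s : ℝ) {t : ℝ} (ht : 0 < t) (θ : ℝ) :
    HasDerivAt (fun θ => eTheta (axisPt s t θ)) (-eR (axisPt s t θ)) θ := by
  have h : HasDerivAt (fun θ => -Real.sin θ • EuclideanSpace.single (0 : Fin 3) (1 : ℝ) +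
      Real.cos θ • EuclideanSpace.single (1 : Fin 3) (1 : ℝ))
      (-Real.cos θ • EuclideanSpace.single (0 : Fin 3) (1 : ℝ) +
        -Real.sin θ • EuclideanSpace.single (1 : Fin 3) (1 : ℝ)) θ :=
    ((Real.hasDerivAt_sin θ).neg.smul_const _).add ((Real.hasDerivAt_cos θ).smul_const _)
  have e1 : (fun θ => eTheta (axisPt s t θ)) = fun θ => -Real.sin θ • EuclideanSpace.single (0 : Fin 3) (1 : ℝ) +
      Real.cos θ • EuclideanSpace.single (1 : Fin 3) (1 : ℝ) := by
    funext θ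
    rw [eTheta_axisPt s ht θ]
    ext i
    fin_cases i <;> simp [rotZ]
  have e2 : -eR (axisPt s t θ) = -Real.cos θ • EuclideanSpace.single (0 : Fin 3) (1 : ℝ) +
      -Real.sin θ • EuclideanSpace.single (1 : Fin 3) (1 : ℝ) := by
    rw [eR_axisPt s ht θ]
    ext i
    fin_cases i <;> simp [rotZ]
  rw [e1, e2]
  exact h

/-- Chain rule along the circle: `∂_θ V(axisPt s t θ) = t • DV(y) ê_θ`. [folklore] -/
theorem hasDerivAt_comp_axisPt {V : EuclideanSpace ℝ (Fin 3) → EuclideanSpace ℝ (Fin 3)} (s : ℝ) {t : ℝ} (ht : 0 < t)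
    (θ : ℝ) (hV : DifferentiableAt ℝ V (axisPt s t θ)) :
    HasDerivAt (fun θ => V (axisPt s t θ)) (t • fderiv ℝ V (axisPt s t θ) (eTheta (axisPt s t θ))) θ := by
  have h := hV.hasFDerivAt.comp_hasDerivAt θ (hasDerivAt_axisPt s ht θ)
  rwa [ContinuousLinearMap.map_smul] at h

/-- **COMPONENT LAW, radial**: `∂_θ V_r = t ⟪DV ê_θ, ê_r⟫ + V_θ` along the circle (`t > 0`, `y = axisPt s t θ`). [folklore] -/
theorem hasDerivAt_radialVelocity_axisPt {V : EuclideanSpace ℝ (Fin 3) → EuclideanSpace ℝ (Fin 3)} (s : ℝ) {t : ℝ}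
    (ht : 0 < t) (θ : ℝ) (hV : DifferentiableAt ℝ V (axisPt s t θ)) :
    HasDerivAt (fun θ => radialVelocity V (axisPt s t θ))
      (t * ⟪fderiv ℝ V (axisPt s t θ) (eTheta (axisPt s t θ)), eR (axisPt s t θ)⟫ +
        swirlVelocity V (axisPt s t θ)) θ := by
  have h := (hasDerivAt_comp_axisPt s ht θ hV).inner ℝ (hasDerivAt_eR_axisPt s ht θ)
  show HasDerivAt (fun θ => ⟪V (axisPt s t θ), eR (axisPt s t θ)⟫) _ θ
  refine h.congr_deriv ?_
  rw [real_inner_smul_left, swirlVelocity]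
  ring

/-- **COMPONENT LAW, angular**: `∂_θ V_θ = t ⟪DV ê_θ, ê_θ⟫ − V_r` along the circle (`t > 0`, `y = axisPt s t θ`). [folklore] -/
theorem hasDerivAt_swirlVelocity_axisPt {V : EuclideanSpace ℝ (Fin 3) → EuclideanSpace ℝ (Fin 3)} (s : ℝ) {t : ℝ}
    (ht : 0 < t) (θ : ℝ) (hV : DifferentiableAt ℝ V (axisPt s t θ)) :
    HasDerivAt (fun θ => swirlVelocity V (axisPt s t θ))
      (t * ⟪fderiv ℝ V (axisPt s t θ) (eTheta (axisPt s t θ)), eTheta (axisPt s t θ)⟫ -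
        radialVelocity V (axisPt s t θ)) θ := by
  have h := (hasDerivAt_comp_axisPt s ht θ hV).inner ℝ (hasDerivAt_eTheta_axisPt s ht θ)
  show HasDerivAt (fun θ => ⟪V (axisPt s t θ), eTheta (axisPt s t θ)⟫) _ θ
  refine h.congr_deriv ?_
  rw [real_inner_smul_left, inner_neg_right, radialVelocity]
  ring

/-- **COMPONENT LAW, axial**: `∂_θ V_z = t ⟪DV ê_θ, ê_z⟫` along the circle (`t > 0`, `y = axisPt s t θ`). [folklore] -/
theorem hasDerivAt_axialVelocity_axisPt {V : EuclideanSpace ℝ (Fin 3) → EuclideanSpace ℝ (Fin 3)} (s : ℝ) {t : ℝ}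
    (ht : 0 < t) (θ : ℝ) (hV : DifferentiableAt ℝ V (axisPt s t θ)) :
    HasDerivAt (fun θ => axialVelocity V (axisPt s t θ))
      (t * ⟪fderiv ℝ V (axisPt s t θ) (eTheta (axisPt s t θ)), eZ⟫) θ := by
  have h := (hasDerivAt_comp_axisPt s ht θ hV).inner ℝ (hasDerivAt_const θ eZ)
  simp only [inner_zero_right, zero_add, real_inner_smul_left] at h
  have e : (fun θ => axialVelocity V (axisPt s t θ)) = fun θ => ⟪V (axisPt s t θ), eZ⟫ := by
    funext θ; simp [axialVelocity, eZ, EuclideanSpace.inner_single_right]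
  rw [e]
  exact h

/-! ### The θ̂-column identity -/

/-- **θ̂-COLUMN IDENTITY** (HOOP-NOTE §4, the frame column used mode by mode): along the circle `axisPt s t ·` (`t > 0`,
`y = axisPt s t θ`, `V` differentiable at `y`),
`t² ‖DV(y) ê_θ‖² = (∂_θ V_r − V_θ)² + (∂_θ V_θ + V_r)² + (∂_θ V_z)²`. [folklore] -/
theorem thetaColumn_sq {V : EuclideanSpace ℝ (Fin 3) → EuclideanSpace ℝ (Fin 3)} (s : ℝ) {t : ℝ} (ht : 0 < t) (θ : ℝ)
    (hV : DifferentiableAt ℝ V (axisPt s t θ)) :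
    t ^ 2 * ‖fderiv ℝ V (axisPt s t θ) (eTheta (axisPt s t θ))‖ ^ 2 =
      (deriv (fun θ => radialVelocity V (axisPt s t θ)) θ - swirlVelocity V (axisPt s t θ)) ^ 2 +
        (deriv (fun θ => swirlVelocity V (axisPt s t θ)) θ + radialVelocity V (axisPt s t θ)) ^ 2 +
        (deriv (fun θ => axialVelocity V (axisPt s t θ)) θ) ^ 2 := by
  rw [(hasDerivAt_radialVelocity_axisPt s ht θ hV).deriv, (hasDerivAt_swirlVelocity_axisPt s ht θ hV).deriv,
    (hasDerivAt_axialVelocity_axisPt s ht θ hV).deriv,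
    norm_sq_eq_polarFrame (fderiv ℝ V (axisPt s t θ) (eTheta (axisPt s t θ))) s ht θ]
  ring

/-- The θ̂-column in `deriv`-free form: the three frame components of `DV(y) ê_θ` ARE `(∂_θV_r − V_θ)/t`, `(∂_θV_θ + V_r)/t`,
`∂_θV_z/t` (`t > 0`). [folklore] -/
theorem fderiv_eTheta_components {V : EuclideanSpace ℝ (Fin 3) → EuclideanSpace ℝ (Fin 3)} (s : ℝ) {t : ℝ} (ht : 0 < t)
    (θ : ℝ) (hV : DifferentiableAt ℝ V (axisPt s t θ)) :
    ⟪fderiv ℝ V (axisPt s t θ) (eTheta (axisPt s t θ)), eR (axisPt s t θ)⟫ =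
        (deriv (fun θ => radialVelocity V (axisPt s t θ)) θ - swirlVelocity V (axisPt s t θ)) / t ∧
      ⟪fderiv ℝ V (axisPt s t θ) (eTheta (axisPt s t θ)), eTheta (axisPt s t θ)⟫ =
        (deriv (fun θ => swirlVelocity V (axisPt s t θ)) θ + radialVelocity V (axisPt s t θ)) / t ∧
      ⟪fderiv ℝ V (axisPt s t θ) (eTheta (axisPt s t θ)), eZ⟫ =
        deriv (fun θ => axialVelocity V (axisPt s t θ)) θ / t := by
  rw [(hasDerivAt_radialVelocity_axisPt s ht θ hV).deriv, (hasDerivAt_swirlVelocity_axisPt s ht θ hV).deriv,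
    (hasDerivAt_axialVelocity_axisPt s ht θ hV).deriv]
  refine ⟨?_, ?_, ?_⟩ <;> field_simp <;> ring

end Summit.NavierStokesRegularity.NavierStokesRegularity.Theorems.PowerGaugeEulerLiouville.HoopCore

end
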